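import Summits.AtomisticToContinuum.HydrodynamicLimit.Theses.TwoClocks
import Summits.AtomisticToContinuum.HydrodynamicLimit.Theses.OneFlightGossipEngine
import Summits.AtomisticToContinuum.HydrodynamicLimit.Theorems.OneFlightGossipEngineClampedCurrentsDockTransferTails
import Summits.AtomisticToContinuum.HydrodynamicLimit.Theorems.ImplosionDichotomyHydroLimitInBandActivityTailsOfTransfer
import HarnessLib

/-!
# Strategist sketch — crux `TwoClocks.TransferActivityTails` (stmt-AtomisticToContinuum-16624)

Typed statements used by `STRATEGY-CENSUS.md` (planner-cstrat-stmt-AtomisticToContinuum-16624-s1-0, 2026-08-17).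
Sorry-free: definitions + checks against LANDED theorems only.

§1 the decomposition package (children = the two EXISTING items stmt-13734 / stmt-17703 of route OneFlightGossipEngine,
   byte-identical; glue-by = the landed `ClampedCurrentsDockTransferTails.stub_transferActivityTails`; converse landed too);
§2 the shape variants discussed under Strengthen (UI-shape weakening; why it is useless for the clock is prose, F1);
§3 the equilibrium sub-Lanford one-block second moment (support candidate, F3) and the hot-collision energy flux (F2).
-/

noncomputable section

open MeasureTheory Set

namespace Summit.AtomisticToContinuum.HydrodynamicLimit.Cruxes.TransferActivityTails.Strategist

open Literature.MathematicalPhysics.KineticTheory Literature.Analysis.FluidPDE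
open Summit.AtomisticToContinuum.HydrodynamicLimit.Theses
open Summit.AtomisticToContinuum.HydrodynamicLimit.Theorems

/-! ## §1 Decomposition package: `TransferActivityTails ⇐ CollisionActivityTails ∧ EnergyActivityTails` -/

/-- Child 1 (momentum half) — the text to file; byte-identical with `OneFlightGossipEngine.CollisionActivityTails`
(item stmt-AtomisticToContinuum-13734, staffed). -/
def ChildMomentum : Prop :=
  ∀ (a₀ θ₀ : Literature.MathematicalPhysics.KineticTheory.T3 → ℝ) (u₀ : Literature.MathematicalPhysics.KineticTheory.T3 → Literature.MathematicalPhysics.KineticTheory.V3), Continuous a₀ → Continuous θ₀ → Continuous u₀ → (∀ x, 0 < a₀ x) → (∀ x, 0 < θ₀ x) → ∃ σ₀ : ℝ, 0 < σ₀ ∧ ∀ σ : ℝ, 0 < σ → σ < σ₀ → ∀ (T : ℝ) (ρ θ : ℝ → Literature.MathematicalPhysics.KineticTheory.T3 → ℝ) (u : ℝ → Literature.MathematicalPhysics.KineticTheory.T3 → Literature.MathematicalPhysics.KineticTheory.V3), Literature.MathematicalPhysics.KineticTheory.IsHardSphereEulerSolution σ T ρ u θ → ∀ Φ : (N : ℕ)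 → Literature.Analysis.FluidPDE.HardSphereFlow (Literature.Analysis.FluidPDE.Torus.geometry (Fin 3)) (Literature.MathematicalPhysics.KineticTheory.hsDiameter σ N) (N + 1), Literature.MathematicalPhysics.KineticTheory.TendstoHydroFieldsAt (fun N => Literature.MathematicalPhysics.KineticTheory.localGibbsLaw σ a₀ u₀ θ₀ N (Φ N)) Φ ρ u θ 0 → ∀ t ∈ Set.Ico 0 T, ∃ V₀ : ℝ, 0 < V₀ ∧ ∀ V : ℝ, V₀ ≤ V → ∀ ε : ℝ, 0 < ε → ∃ τ₀ : ℝ, 0 < τ₀ ∧ ∀ τ : ℝ, τ₀ ≤ τ → ∃ N₀ : ℕ, ∀ N : ℕ, N₀ ≤ N → ∀ s ∈ Set.Icc 0 t, (let w : ℝ := τ * ((N : ℝ) + 1) ^ (-(1 / 3 : ℝ)); let P := Literature.MathematicalPhysics.KineticTheory.localGibbsLaw σ a₀ u₀ θ₀ N (Φ N); let act := fun (i : Fin (N + 1)) (z : Literature.Analysis.FluidPDE.Config (N + 1) (Fin 3) Literature.MathematicalPhysics.KineticTheory.T3) => σ / τ * (Φ N).collisionSum (Set.Ioc s (s + w)) (fun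 c => if c.fst = i then ‖c.postVel.1 - c.preVel.1‖ else 0) z; ∫⁻ z, ENNReal.ofReal (((N : ℝ) + 1)⁻¹ * ∑ i : Fin (N + 1), Set.indicator {y : ℝ | V < y} (fun y => y) (act i z)) ∂P ≤ ENNReal.ofReal ε)

/-- Child 2 (energy half) — the text to file; byte-identical with `OneFlightGossipEngine.EnergyActivityTails`
(item stmt-AtomisticToContinuum-17703, filed 2026-08-17 by the judge-repair of route OneFlightGossipEngine). -/
def ChildEnergy : Prop :=
  ∀ (a₀ θ₀ : Literature.MathematicalPhysics.KineticTheory.T3 → ℝ) (u₀ : Literature.MathematicalPhysics.KineticTheory.T3 → Literature.MathematicalPhysics.KineticTheory.V3), Continuous a₀ → Continuous θ₀ → Continuous u₀ → (∀ x, 0 < a₀ x) → (∀ x, 0 < θ₀ x) → ∃ σ₀ : ℝ, 0 < σ₀ ∧ ∀ σ : ℝ, 0 < σ → σ < σ₀ → ∀ (T : ℝ) (ρ θ : ℝ → Literature.MathematicalPhysics.KineticTheory.T3 → ℝ) (u : ℝ → Literature.MathematicalPhysics.KineticTheory.T3 → Literature.MathematicalPhysics.KineticTheory.V3), Literature.MathematicalPhysics.KineticTheory.IsHardSphereEulerSolution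 σ T ρ u θ → ∀ Φ : (N : ℕ) → Literature.Analysis.FluidPDE.HardSphereFlow (Literature.Analysis.FluidPDE.Torus.geometry (Fin 3)) (Literature.MathematicalPhysics.KineticTheory.hsDiameter σ N) (N + 1), Literature.MathematicalPhysics.KineticTheory.TendstoHydroFieldsAt (fun N => Literature.MathematicalPhysics.KineticTheory.localGibbsLaw σ a₀ u₀ θ₀ N (Φ N)) Φ ρ u θ 0 → ∀ t ∈ Set.Ico 0 T, ∃ V₀ : ℝ, 0 < V₀ ∧ ∀ V : ℝ, V₀ ≤ V → ∀ ε : ℝ, 0 < ε → ∃ τ₀ : ℝ, 0 < τ₀ ∧ ∀ τ : ℝ, τ₀ ≤ τ → ∃ N₀ : ℕ, ∀ N : ℕ, N₀ ≤ N → ∀ s ∈ Set.Icc 0 t, (let w : ℝ := τ * ((N : ℝ) + 1) ^ (-(1 / 3 : ℝ)); let P := Literature.MathematicalPhysics.KineticTheory.localGibbsLaw σ a₀ u₀ θ₀ N (Φ N); let act := fun (i : Fin (N + 1)) z => σ / τ * (Φ N).collisionSum (Set.Ioc s (s + w)) (fun c => if c.fst = i then |‖c.postVel.1‖ ^ 2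 - ‖c.preVel.1‖ ^ 2| / 2 else 0) z; ∫⁻ z, ENNReal.ofReal (((N : ℝ) + 1)⁻¹ * ∑ i : Fin (N + 1), Set.indicator {y : ℝ | V < y} (fun y => y) (act i z)) ∂P ≤ ENNReal.ofReal ε)

/-- dedup check: child 1 IS stmt-13734's decl. -/
theorem childMomentum_iff : ChildMomentum ↔ OneFlightGossipEngine.CollisionActivityTails := Iff.rfl

/-- dedup check: child 2 IS stmt-17703's decl. -/
theorem childEnergy_iff : ChildEnergy ↔ OneFlightGossipEngine.EnergyActivityTails := Iff.rfl

/-- child 2 is also the heart's / the dock's `CollisionEnergyActivityTails` (the copy the landed glue is typed over). -/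
theorem childEnergy_iff_dock : ChildEnergy ↔ ClampedCurrentsDockTransferTails.CollisionEnergyActivityTails := Iff.rfl

/-- **GLUE (what `--glue-by` must elaborate)**: the landed `stub_transferActivityTails` has exactly the type
`Child₁ → Child₂ → TwoClocks.TransferActivityTails` up to unfolding of definitions. -/
theorem transferActivityTails_of_subs :
    ChildMomentum → ChildEnergy → TwoClocks.TransferActivityTails :=
  fun h₁ h₂ => ClampedCurrentsDockTransferTails.stub_transferActivityTails h₁ h₂

/-- The same glue stated over the two EXISTING item decls by name. -/
theorem transferActivityTails_of_items :
    OneFlightGossipEngine.CollisionActivityTails → OneFlightGossipEngine.EnergyActivityTails →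
      TwoClocks.TransferActivityTails :=
  fun h₁ h₂ => ClampedCurrentsDockTransferTails.stub_transferActivityTails h₁ h₂

/-- **Converse (landed)**: the crux implies both children — so the split is an EQUIVALENCE (16624 ⟺ 13734 ∧ 17703);
neither child alone is the crux (different summands), each is substantive (open, crux-grade on its own route). -/
theorem subs_of_transferActivityTails (h : TwoClocks.TransferActivityTails) :
    OneFlightGossipEngine.CollisionActivityTails ∧ OneFlightGossipEngine.EnergyActivityTails :=
  HydroLimitInBandHeart.activityTails_of_transferActivityTails h

/-! ## §2 Shape variants (Strengthen / weaken) -/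

/-- The crux's frame, abstracted over the conclusion (as in the live line's `InCruxFrame`). -/
def InFrame (Q : (σ : ℝ) → ℝ → ((N : ℕ) → HardSphereFlow (Torus.geometry (Fin 3)) (hsDiameter σ N) (N + 1)) →
    ((N : ℕ) → Measure (Config (N + 1) (Fin 3) T3)) → Prop) : Prop :=
  ∀ (a₀ θ₀ : T3 → ℝ) (u₀ : T3 → V3), Continuous a₀ → Continuous θ₀ → Continuous u₀ →
    (∀ x, 0 < a₀ x) → (∀ x, 0 < θ₀ x) → ∃ σ₀ : ℝ, 0 < σ₀ ∧ ∀ σ : ℝ, 0 < σ → σ < σ₀ →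
    ∀ (T : ℝ) (ρ θ : ℝ → T3 → ℝ) (u : ℝ → T3 → V3), IsHardSphereEulerSolution σ T ρ u θ →
    ∀ Φ : (N : ℕ) → HardSphereFlow (Torus.geometry (Fin 3)) (hsDiameter σ N) (N + 1),
    TendstoHydroFieldsAt (fun N => localGibbsLaw σ a₀ u₀ θ₀ N (Φ N)) Φ ρ u θ 0 →
    ∀ t ∈ Set.Ico 0 T, Q σ t Φ (fun N => localGibbsLaw σ a₀ u₀ θ₀ N (Φ N))

/-- The window transfer activity of particle `i` over `(s, s+w]`, `w = τ (N+1)^{-1/3}` (the crux's `act`). -/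
def act (σ τ : ℝ) {N : ℕ} (Φ : HardSphereFlow (Torus.geometry (Fin 3)) (hsDiameter σ N) (N + 1))
    (s : ℝ) (i : Fin (N + 1)) (z : Config (N + 1) (Fin 3) T3) : ℝ :=
  σ / τ * Φ.collisionSum (Set.Ioc s (s + τ * ((N : ℝ) + 1) ^ (-(1 / 3 : ℝ))))
    (fun c => if c.fst = i then ‖c.postVel.1 - c.preVel.1‖ + |‖c.postVel.1‖ ^ 2 - ‖c.preVel.1‖ ^ 2| / 2 else 0) z

/-- **UI-SHAPE weakening** of the crux (`V₀` chosen AFTER the accuracy `ε`): `∀ ε ∃ V ∃ τ₀ ∀ τ ≥ τ₀ ∃ N₀ ∀ N ∀ s`.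
Provable-grade at equilibrium (F3: sub-Lanford one-block second moment + stationarity + Jensen), but USELESS for the
clock (F1: the Grönwall factor `e^{t/β₀(V)}` with `β₀(V) ≲ log V / V` forced on crux 3 by the 14441 blob family). -/
def TransferActivityTailsUIShape : Prop :=
  InFrame fun σ t Φ P => ∀ ε : ℝ, 0 < ε → ∃ V : ℝ, 0 < V ∧ ∃ τ₀ : ℝ, 0 < τ₀ ∧ ∀ τ : ℝ, τ₀ ≤ τ →
    ∃ N₀ : ℕ, ∀ N : ℕ, N₀ ≤ N → ∀ s ∈ Set.Icc 0 t,
      ∫⁻ z, ENNReal.ofReal (((N : ℝ) + 1)⁻¹ * ∑ i : Fin (N + 1),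
          Set.indicator {y : ℝ | V < y} (fun y => y) (act σ τ (Φ N) s i z)) ∂(P N) ≤ ENNReal.ofReal ε

/-- The crux (fixed-level LLN shape) trivially implies its UI shape. -/
theorem uiShape_of_crux (h : TwoClocks.TransferActivityTails) : TransferActivityTailsUIShape := by
  intro a₀ θ₀ u₀ ha hθ hu ha0 hθ0
  obtain ⟨σ₀, hσ₀, H⟩ := h a₀ θ₀ u₀ ha hθ hu ha0 hθ0
  refine ⟨σ₀, hσ₀, fun σ hσ hσlt T ρ θ u hE Φ hlim t ht ε hε => ?_⟩
  obtain ⟨V₀, hV₀, H⟩ := H σ hσ hσlt T ρ θ u hE Φ hlim t ht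
  obtain ⟨τ₀, hτ₀, H⟩ := H V₀ le_rfl ε hε
  exact ⟨V₀, hV₀, τ₀, hτ₀, fun τ hτ => H τ hτ⟩

/-- **L²-SHAPE strengthening at fixed level** (S⁺₂ of the census): a uniform SECOND-moment bound of the window activity
under the true law, `∃ M ∃ τ₀ ∀ τ ≥ τ₀ ∃ N₀ ∀ N ∀ s, E[(N+1)⁻¹ Σ_i act_i²] ≤ M`.  It gives the UI shape (Chebyshev:
tail_V ≤ act²/V) and NOT the crux; its equilibrium instance is what F3 reaches (block Jensen); off equilibrium it is
(N2)-grade like the crux.  Typed to record that "moment currency" does not change the verdict. -/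
def TransferActivitySecondMomentBound : Prop :=
  InFrame fun σ t Φ P => ∃ M : ℝ, 0 ≤ M ∧ ∃ τ₀ : ℝ, 0 < τ₀ ∧ ∀ τ : ℝ, τ₀ ≤ τ →
    ∃ N₀ : ℕ, ∀ N : ℕ, N₀ ≤ N → ∀ s ∈ Set.Icc 0 t,
      ∫⁻ z, ENNReal.ofReal (((N : ℝ) + 1)⁻¹ * ∑ i : Fin (N + 1), (act σ τ (Φ N) s i z) ^ 2) ∂(P N) ≤
        ENNReal.ofReal M

/-! ## §3 Equilibrium sub-Lanford one-block second moment (support candidate, F3) and the hot energy flux (F2) -/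

/-- **EQUILIBRIUM SHORT-BLOCK SECOND MOMENT** (F3; a SUPPORT-grade statement, not a crux piece): under the canonical Gibbs
law with constant profiles there is a block-length constant `c` (a fraction of Lanford's time in mean-free-time units:
block `τ₁ (N+1)^{-1/3}` with `τ₁ ≤ c/σ²` spans `≲ c` mean free times) such that the one-block transfer activity has an
`N`-uniform second moment.  With stationarity (`measurePreserving_flow_localGibbsLaw`) and Jensen over `K = τ/τ₁` blocks it
yields `E_G[act_τ²] ≤ M` for ALL `τ ≥ τ₁`, hence the equilibrium UI shape — and nothing more (F1). Intended proof:
Lanford–King a-priori marginal bounds at FIXED small packing for sub-Lanford kinetic times from flux-weighted (Palm) Gibbs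
data + the landed flux formulas; the tagged collision cluster is dominated by a two-type (speed-marked) branching process
whose mean kernel `c τ₁σ² |u−u'| M_θ(u') du'` has spectral radius `O(τ₁σ²√θ)` (rank-two), so fast ancestors do not spoil
subcriticality (answer to the one-type tube-percolation objection in `A1-OneBlockUI-analysis.md` / `COORD-a1.md`). -/
def EquilibriumShortBlockSecondMoment : Prop :=
  ∃ c : ℝ, 0 < c ∧ ∀ (a₀ θ₀ : ℝ) (u₀ : V3), 0 < a₀ → 0 < θ₀ → ∃ σ₀ : ℝ, 0 < σ₀ ∧ ∀ σ : ℝ, 0 < σ → σ < σ₀ →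
    ∀ τ₁ : ℝ, 0 < τ₁ → τ₁ * σ ^ 2 * (1 + Real.sqrt θ₀ + ‖u₀‖) ≤ c →
    ∃ M : ℝ, 0 ≤ M ∧ ∀ (N : ℕ) (Φ : HardSphereFlow (Torus.geometry (Fin 3)) (hsDiameter σ N) (N + 1)),
      ∫⁻ z, ENNReal.ofReal ((act σ τ₁ Φ 0 0 z) ^ 2)
        ∂(localGibbsLaw σ (fun _ => a₀) (fun _ => u₀) (fun _ => θ₀) N Φ) ≤ ENNReal.ofReal M

/-- **HOT-COLLISION ENERGY FLUX VANISHES** (F2; the provable-from-an-envelope piece of the attempted reduction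
"energy half ⇐ momentum half ∧ marginal envelope"): the window-normalised mean energy throughput of collisions with a
partner faster than `Θ` tends to `0` as `Θ → ∞`, uniformly in `N, τ, s`.  Under a `k = 2` Gaussian marginal envelope on
`[0,t]` it follows from the landed flux upper bounds (`≈ σ³ C² ∫∫_{max(|v|,|v⁎|)>Θ} (|v|²+|v⁎|²)|v−v⁎| M_β M_β`).  It closes the
energy half from the momentum half in UI SHAPE ONLY (Θ must grow with 1/ε, which pushes the momentum level `V/(2Θ)`
below `V₀`): the precise point where "energy ⊄ momentum + kinetic/envelope input" (Disproof §3(d)) bites. -/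
def HotCollisionEnergyFluxVanishes : Prop :=
  InFrame fun σ t Φ P => ∀ ε : ℝ, 0 < ε → ∃ Θ : ℝ, 0 < Θ ∧ ∀ τ : ℝ, 0 < τ → ∃ N₀ : ℕ, ∀ N : ℕ, N₀ ≤ N →
    ∀ s ∈ Set.Icc 0 t,
      ∫⁻ z, ENNReal.ofReal (((N : ℝ) + 1)⁻¹ * (σ / τ *
          (Φ N).collisionSum (Set.Ioc s (s + τ * ((N : ℝ) + 1) ^ (-(1 / 3 : ℝ))))
            (fun c => if Θ < max ‖c.preVel.1‖ ‖c.preVel.2‖ then ‖c.preVel.1‖ ^ 2 + ‖c.preVel.2‖ ^ 2 else 0) z))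
        ∂(P N) ≤ ENNReal.ofReal ε

end Summit.AtomisticToContinuum.HydrodynamicLimit.Cruxes.TransferActivityTails.Strategist

end
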